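import Summits.CriticalPhenomena.PercolationContinuityZ3.Theorems.PercNearOneGluingNoHeavyQuantFlowPieces
import Summits.CriticalPhenomena.PercolationContinuityZ3.Theorems.PercNearOneGluingNoHeavyQuantLawDecFlowsDecomposition
import Summits.CriticalPhenomena.PercolationContinuityZ3.Theorems.PercNearOneGluingNoHeavyQuantGatedConvSplit
import HarnessLib

/-!
# QUANT lane R8, T-DEC: THE GATE STEP IS FREE AT EVERY LAYER WITHOUT A NONZERO LOW — gating ANY top-affordable probability law gives a law
# that is DEC(j) at the gated floor and target as soon as no charged atom `1 ≤ l ≤ j` has `2l < q·T` (first-moment criterion; no DEC hypothesis)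

builds on p205010 (kernel theorem, internal audit signed; external expert review pending)

Support file (`--supports stmt-CriticalPhenomena-4575`), QUANT lane LEAD seat prim-quant-lead (gen 41), rung R8 of
`run/shared/lean/prim/quant/LADDER.md`; memo `run/shared/lean/prim/quant/prim-quant-lead-g41/LEAD-NOTES-G41.md` N1 (Lemma 2).  Theorems only,
standard axioms, no sorries.  Companion of `…QuantGateBelowQuantile` (lead g41, `flowAtT_gate_of_tail_ge`: the gate step below the floor-quantile).

THE POINT.  `gate μ q = q·μ + (1−q)·δ₀`; at floor `q·x`, target `q·T` (`T` the mean of `μ`, `x·M ≤ T`), layer `j`, if the only charged low of the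
gated law is the atom `0` (no `μ l > 0` with `1 ≤ l ≤ j`, `2l < qT`), then arm-2's first-moment criterion `flowAtT_of_moment` applies verbatim:
(i) the only charged low is `0`; (ii) `qx·M ≤ qT`; (iii) the mean of the gated law is `qT` = the target times its mass.  So the gated law is
DEC(j) — with EQUALITY exactly on census-2 g69's (M) class (TA-tight top, no mass in `(0, qT]`: lead g41's two-block identity
`1 − q + q(1−g)² = (1−g)(1−2qg) + g(1−qg)`).  Together with `…QuantGateBelowQuantile` this makes the open content of the gate/conv step of the
SDEC tree induction, in the kernel, the layers ABOVE the floor-quantile of the ungated law that CARRY a nonzero low (regime R of the memo).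

* **`LawDec.flowAtT_gate_of_noNonzeroLow`** — `μ ≥ 0` on `{0..M}` with mass `1` and mean `T > 0`, `x·M ≤ T`, `0 < x < 1`, `0 < q ≤ 1`, and
  `μ l = 0` for every `1 ≤ l ≤ j` with `2l < qT` ⟹ `FlowAtT (qx) (qT) j M (gate μ q)`.
* **`LawDec.decAtT_gate_of_noNonzeroLow`**, **`LawDec.decAt_gate_of_noNonzeroLow`** — DEC forms (explicit target / at the mean).
HONEST STATUS: nothing conjectural here; `SGCGiantStep`, `SDECConvClosed(TB)(AboveQuantile)`, `FarTreeRow` remain OPEN; the RATE class log\* and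
the honest sentence of `run/shared/lean/prim/quant/README.md` are unchanged.

[this work]; first-moment criterion: prim-quant-arm-2 g34/g37 (`flowAtT_of_moment`), flow normal form: prim-quant-stmt g22 (this lane).  Nothing here is a
published result.  The gluing rows served [cite: KozmaNitzan2024, Conjecture 3 (p. 15)]; product measure [cite: Grimmett1999, §1.3 p. 10].
-/

noncomputable section

namespace Summit.CriticalPhenomena.PercolationContinuityZ3.Theorems

namespace Quant

open Finset

namespace LawDec

/-- **THE GATE STEP WITHOUT A NONZERO LOW (flow form).**  See the file header. [this work] -/
theorem flowAtT_gate_of_noNonzeroLow (x T q : ℝ) (j M : ℕ) (μ : ℕ → ℝ) (hx0 : 0 < x) (hx1 : x < 1) (hq0 : 0 < q) (hq1 : q ≤ 1)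
    (hT : 0 < T) (hμ0 : ∀ h, 0 ≤ μ h) (hμ1 : ∑ h ∈ Finset.range (M + 1), μ h = 1)
    (hmean : ∑ h ∈ Finset.range (M + 1), (h : ℝ) * μ h = T) (hta : x * (M : ℝ) ≤ T)
    (hnolow : ∀ l, 1 ≤ l → l ≤ j → 2 * (l : ℝ) < q * T → μ l = 0) :
    FlowAtT (q * x) (q * T) j M (gate μ q) := by
  have hqx0 : 0 < q * x := mul_pos hq0 hx0
  have hqx1 : q * x < 1 := by nlinarith
  have hqT : 0 < q * T := mul_pos hq0 hT
  refine flowAtT_of_moment (q * x) (q * T) j M (gate μ q) hqx0 hqx1 hqT (fun h => ?_) (fun l hl1 hlj hlow => ?_) ?_ ?_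
  · rw [gate_apply]
    have := hμ0 h
    split_ifs <;> nlinarith
  · rw [gate_apply, hnolow l hl1 hlj hlow, if_neg (by omega)]; ring
  · rw [mul_assoc]; exact mul_le_mul_of_nonneg_left hta hq0.le
  · rw [sum_gate μ q M hμ1, sum_mul_gate, hmean, mul_one]

/-- **DEC form (explicit target).** [this work] -/
theorem decAtT_gate_of_noNonzeroLow (x T q : ℝ) (j M : ℕ) (μ : ℕ → ℝ) (hx0 : 0 < x) (hx1 : x < 1) (hq0 : 0 < q) (hq1 : q ≤ 1)
    (hT : 0 < T) (hμ0 : ∀ h, 0 ≤ μ h) (hμM : ∀ h, M < h → μ h = 0) (hμ1 : ∑ h ∈ Finset.range (M + 1), μ h = 1)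
    (hmean : ∑ h ∈ Finset.range (M + 1), (h : ℝ) * μ h = T) (hta : x * (M : ℝ) ≤ T)
    (hnolow : ∀ l, 1 ≤ l → l ≤ j → 2 * (l : ℝ) < q * T → μ l = 0) :
    DECAtT (q * x) (q * T) j M (gate μ q) := by
  have hqx0 : 0 < q * x := mul_pos hq0 hx0
  have hqx1 : q * x < 1 := by nlinarith
  obtain ⟨_, gM, g1⟩ := gate_laws M μ q hq0.le hq1 hμ0 hμM hμ1
  exact decAtT_of_flowAtT (q * x) (q * T) j M (gate μ q) hqx0 hqx1 gM g1
    (flowAtT_gate_of_noNonzeroLow x T q j M μ hx0 hx1 hq0 hq1 hT hμ0 hμ1 hmean hta hnolow)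

/-- **DEC form (at the mean of the gated law)**: a top-affordable probability law `μ` on `{0..M}` (mean `T > 0`, `x·M ≤ T`) whose atoms
`1 ≤ l ≤ j` with `2l < q·T` are uncharged has `DECAt (q·x) j M (gate μ q)`. [this work] -/
theorem decAt_gate_of_noNonzeroLow (x q : ℝ) (j M : ℕ) (μ : ℕ → ℝ) (hx0 : 0 < x) (hx1 : x < 1) (hq0 : 0 < q) (hq1 : q ≤ 1)
    (hμ0 : ∀ h, 0 ≤ μ h) (hμM : ∀ h, M < h → μ h = 0) (hμ1 : ∑ h ∈ Finset.range (M + 1), μ h = 1)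
    (hT : 0 < ∑ h ∈ Finset.range (M + 1), (h : ℝ) * μ h)
    (hta : x * (M : ℝ) ≤ ∑ h ∈ Finset.range (M + 1), (h : ℝ) * μ h)
    (hnolow : ∀ l, 1 ≤ l → l ≤ j → 2 * (l : ℝ) < q * ∑ h ∈ Finset.range (M + 1), (h : ℝ) * μ h → μ l = 0) :
    DECAt (q * x) j M (gate μ q) := by
  rw [decAt_iff_decAtT, sum_mul_gate]
  exact decAtT_gate_of_noNonzeroLow x _ q j M μ hx0 hx1 hq0 hq1 hT hμ0 hμM hμ1 rfl hta hnolow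

end LawDec

end Quant

end Summit.CriticalPhenomena.PercolationContinuityZ3.Theorems
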